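import Mathlib.LinearAlgebra.Span.Basic
import Mathlib.LinearAlgebra.Quotient.Basic
import Mathlib.Algebra.Module.Submodule.Ker
import Mathlib.Algebra.Module.Submodule.Range
import Mathlib.RingTheory.Ideal.Operations
import Mathlib.RingTheory.Nakayama
import Mathlib.Algebra.BigOperators.Group.Finset.Basic
import Mathlib.Algebra.Module.BigOperators
import Mathlib.Tactic.Abel
import Mathlib.Tactic.Ring
import HarnessLib

/-!
# First-order lifts of divisor-supported sheaves, and the obstruction of modules of infinite projective dimension
# along a deformation that displaces a hypersurface singularity (the node obstruction for Θ-supported secant sheaves)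

Family `hodge`, layer `Literature/AlgebraicGeometry/HodgeTheory`. Fully PROVED statements (no named fact, no new
definition). Companion of `SemiregularityWeakCriterion.lean` (the weak criterion (W) of E. Markman, arXiv:2509.23403
Question 11.4, and its first-order consequence: under (W) a sheaf lifts to first order along every Kodaira–Spencer class
keeping its Chern character of Hodge type — Buchweitz–Flenner [`BuchweitzFlenner2003`, §1 and Cor. 4.3]). This file holds
the commutative algebra behind the ladder note `papers/HodgeConjecture/hodge-weil-ladder` (P1, generation 3), Theorem B″:

> the Θ-supported secant sheaves `F_d = e_*𝓘_{Z_d}(Θ)` of [`Markman2025SecantWeil`, Example 8.2.4] (v2 PDF p. 54–55; held text chunk 44–45, numbered "8.2.5" there: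
> "`W_{2,p}` … passes through the singularities of `Θ` (the two `g¹₃`'s) and is thus a Weil divisor … `Z_d := W_{2,p} ∪ ⋃ C_i`
> … `F_d := e_*𝓘_{Z_d}(Θ)` … it can be semi-regular for at most finitely many values of `d`") do NOT lift to first order along
> any principally polarized direction `ξ` that smooths a node of `Θ` (those with `⟨ξ, Q⟩ ≠ 0`, `Q` the tangent cone = the
> quadric through the canonical curve, [`ArbarelloEtAl1985`, Ch. VI §4, heat equation]); since every such `ξ` annihilates
> `ch(F_d) ∈ ℚ[Θ]`, `F_d` violates the weak criterion for every `d`, unconditionally.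

The two algebraic steps, in the elementwise style of `SemiregularityWeakCriterion` (a ring element `ε` with `ε * ε = 0`
plays the dual numbers; "flat over `ℂ[ε]`" is `ker(ε •) ⊆ ε • F`):

* `SupportLemma` — **Lemma S.** Let `A` be a commutative ring (`= 𝒪_{X_ε,x}`), `ε, θ ∈ A`, `F` an `A`-module which is
  `ε`-flat, with `θ` acting as zero on `F̄ := F/εF` (so `F̄` is a module on the divisor `{θ = 0}` of `X = {ε = 0}`), and such
  that EVERY `A`-linear endomorphism of `F̄` is a homothety (`𝓔nd_{𝒪_Θ}(M) = 𝒪_Θ`: rank-one torsion-free `M` on a normal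
  `Θ`). Then `θ` can be corrected by a multiple of `ε` so as to annihilate `F`: `(θ - ε h) • F = 0`
  (`exists_sub_mul_smul_eq_zero_of_endomorphisms_scalar`), and then the annihilator of `F` is exactly the principal ideal
  `(θ - ε h)` (`dvd_of_smul_eq_zero_of_faithful`). Geometrically: a flat first-order lift of `e_*M` is `e'_*M_ε` for a flat
  lift `M_ε` of `M` to an embedded first-order deformation `Θ'_ε = {θ - εh = 0}` of `Θ` inside `X_ε`.
* `SmoothingObstruction` — **Lemma N.** Let `S` be a commutative ring (`= 𝒪_{X,x₀}`, regular), `f ∈ S` (`Θ = {f = 0}`),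
  `(A, B)` a matrix factorization `A * B = f · 1` [`Eisenbud1980`, §5–6] presenting the `S/(f)`-module `M = coker A`, and
  `N` an `S`-module, `f`-flat (`ker(f •) ⊆ f • N`), containing elements `n_k` which satisfy the relations of `M` modulo `f • N`
  (`∑_i A_{ij} • n_i ∈ f • N`). Then `n_k ∈ ∑_j B_{jk} • N + f • N` (`generator_mem_of_matrixFactorization_lift`); if the
  entries of `B` and `f` lie in an ideal `𝔪` contained in the Jacobson radical and the `n_k` generate `N`, then `N = 0`
  (`eq_bot_of_matrixFactorization_lift`). WHY this is the node obstruction: the local ring of a first-order deformation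
  `{f + εh = 0}` with `h(x₀) ≠ 0` (the node MOVES: `⟨ξ,Q⟩ ≠ 0`) is `S[ε]/(ε², f + εh) ≅ S/(f²)` with `ε = -f/h`, so a
  `ℂ[ε]`-flat lift of `M` is exactly an `f`-flat `S`-module `N` with `N/fN ≅ M`; Lemma N says a maximal Cohen–Macaulay
  `M` without free summands (`B ⊂ 𝔪`) has none. Taking syzygies, NO module of infinite projective dimension over
  `𝒪_{Θ,x₀}` lifts — in particular no rank-one torsion-free `M` whose reflexive hull is not invertible at `x₀` (its class in
  `Cl(𝒪_{Θ,x₀})` is non-zero, so `pd = ∞` by MacRae / Bourbaki AC VII §4.7), such as `𝓘_{W_{2,p}}(Θ)` at a node.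

## What is NOT here

No geometry (no theta divisors, Kodaira–Spencer classes, Atiyah classes — see the ladder's DIVERGENCE.md D5); the heat-equation
identification of the local deformation class with `⟨ξ, Q_{x₀}⟩`, the existence of matrix factorizations, the syzygy and
MacRae arguments, and the numerical statement "on a principally polarized abelian fourfold a Θ-supported rank-one K-secant
sheaf has non-invertible reflexive hull" are in the ladder note (THETA-NODE-OBSTRUCTION.md) with their classical sources.
-/

namespace Literature.AlgebraicGeometry.HodgeTheory

open scoped BigOperators

section SupportLemma

/-! ### Lemma S: flat lifts of modules supported on a divisor are supported on a deformed divisor -/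

variable {A : Type*} [CommRing A] {F : Type*} [AddCommGroup F] [Module A F]

/-- **Lemma S (support lemma).** `A` a commutative ring with `ε * ε = 0`; `F` an `A`-module, flat over the dual numbers in
the elementwise sense `ε • s = 0 → s ∈ ε • F` (`hflat`); `P = ε • F` (`hP`); `θ ∈ A` kills `F/εF` (`hθ`: `θ • s ∈ ε • F`);
and every `A`-linear endomorphism of `F ⧸ P` is multiplication by a scalar (`hEnd`; for `F/εF = e_*M` with `M` torsion free of
rank one on a normal divisor `Θ = {θ = 0}` this is `𝓔nd_{𝒪_Θ}(M) = 𝒪_Θ`). Then there is `h ∈ A` with `(θ - ε h) • F = 0`: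
the lift `F` lives on the first-order deformation `{θ - εh = 0}` of the divisor. (Proof: `θ : F → εF ≅ F/εF` descends to an
endomorphism of `F/εF`, which is a homothety `h`.) Used for [Markman2025SecantWeil, Example 8.2.4] in the ladder note P1 gen 3.
[cite: BuchweitzFlenner2003, §1 (first-order deformations of modules, [Ill] (3.4))] -/
theorem exists_sub_mul_smul_eq_zero_of_endomorphisms_scalar {ε θ : A} (hε2 : ε * ε = 0)
    (P : Submodule A F) (hP : ∀ x : F, x ∈ P ↔ ∃ t : F, x = ε • t)
    (hflat : ∀ s : F, ε • s = 0 → ∃ t : F, s = ε • t)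
    (hθ : ∀ s : F, ∃ u : F, θ • s = ε • u)
    (hEnd : ∀ φ : (F ⧸ P) →ₗ[A] (F ⧸ P), ∃ h : A, ∀ x : F ⧸ P, φ x = h • x) :
    ∃ h : A, ∀ s : F, (θ - ε * h) • s = 0 := by
  -- choose, once and for all, `u s` with `θ • s = ε • u s`
  obtain ⟨u, hu⟩ : ∃ u : F → F, ∀ s : F, θ • s = ε • u s :=
    ⟨fun s => Classical.choose (hθ s), fun s => Classical.choose_spec (hθ s)⟩
  -- the class of `u s` modulo `P = εF` does not depend on the choice
  have hwd : ∀ (s v : F), θ • s = ε • v → P.mkQ (u s) = P.mkQ v := by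
    intro s v hv
    have h0 : ε • (u s - v) = 0 := by rw [smul_sub, ← hu s, hv, sub_self]
    obtain ⟨t, ht⟩ := hflat _ h0
    rw [← sub_eq_zero, ← map_sub, Submodule.mkQ_apply, Submodule.Quotient.mk_eq_zero, hP]
    exact ⟨t, ht⟩
  -- the would-be endomorphism `θ : F → εF ≅ F/εF`, as a linear map `F → F/εF`
  let g : F →ₗ[A] (F ⧸ P) :=
    { toFun := fun s => P.mkQ (u s)
      map_add' := by
        intro s s'
        have hsum : θ • (s + s') = ε • (u s + u s') := by rw [smul_add, smul_add, hu s, hu s']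
        show P.mkQ (u (s + s')) = P.mkQ (u s) + P.mkQ (u s')
        rw [hwd (s + s') _ hsum, map_add]
      map_smul' := by
        intro a s
        have hsm : θ • (a • s) = ε • (a • u s) := by rw [smul_comm θ a s, hu s, smul_comm a ε]
        simp only [RingHom.id_apply]
        rw [hwd (a • s) _ hsm, map_smul] }
  have hg : ∀ s : F, g s = P.mkQ (u s) := fun s => rfl
  -- `g` kills `P = εF`, so it descends to an endomorphism of `F/εF`
  have hker : P ≤ LinearMap.ker g := by
    intro x hx
    obtain ⟨t, rfl⟩ := (hP x).mp hx
    obtain ⟨v, hv⟩ := hθ t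
    have hεt : θ • (ε • t) = ε • (θ • t) := smul_comm θ ε t
    rw [LinearMap.mem_ker, hg, hwd (ε • t) (θ • t) hεt, Submodule.mkQ_apply, Submodule.Quotient.mk_eq_zero, hP]
    exact ⟨v, hv⟩
  obtain ⟨h, hh⟩ := hEnd (P.liftQ g hker)
  refine ⟨h, fun s => ?_⟩
  -- φ [s] = g s = [u s] and φ [s] = h • [s], so u s = h • s + ε • t
  have h1 : P.liftQ g hker (P.mkQ s) = P.mkQ (u s) := by
    rw [Submodule.mkQ_apply, Submodule.liftQ_apply, hg, Submodule.mkQ_apply]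
  have h2 := hh (P.mkQ s)
  rw [h1, ← map_smul, ← sub_eq_zero, ← map_sub, Submodule.mkQ_apply, Submodule.Quotient.mk_eq_zero, hP] at h2
  obtain ⟨t, ht⟩ := h2
  have hut : u s = h • s + ε • t := by rw [← ht]; abel
  calc (θ - ε * h) • s = θ • s - (ε * h) • s := sub_smul _ _ _
    _ = ε • (h • s + ε • t) - (ε * h) • s := by rw [hu s, hut]
    _ = 0 := by simp only [smul_add, smul_smul, hε2, zero_smul, add_zero, sub_self]

/-- **Lemma S, second half: the annihilator of the lift is principal.** In the situation of
`exists_sub_mul_smul_eq_zero_of_endomorphisms_scalar`, assume moreover that `F/εF` is FAITHFUL on the divisor, in the form: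
an element of `A` killing `F/εF` lies in the ideal `(θ, ε)` (`hann`; for `e_*M` with `M` torsion free on the integral divisor
`Θ = {θ = 0}` the annihilator of `M` in `𝒪_X` is exactly `(θ)`). Then every element of `A` annihilating `F` is a multiple of
`θ - ε h`: the scheme-theoretic support `V(Ann F)` of the lift is the flat first-order deformation `{θ - εh = 0}` of `Θ`, an
embedded deformation of `Θ` inside `X_ε` canonically attached to `F`; local pieces therefore glue.
[cite: BuchweitzFlenner2003, §1] -/
theorem dvd_of_smul_eq_zero_of_faithful {ε θ h : A} (hε2 : ε * ε = 0)
    (hflat : ∀ s : F, ε • s = 0 → ∃ t : F, s = ε • t)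
    (hann : ∀ a : A, (∀ s : F, ∃ u : F, a • s = ε • u) → ∃ b c : A, a = b * θ + ε * c)
    (hh : ∀ s : F, (θ - ε * h) • s = 0)
    {a : A} (ha : ∀ s : F, a • s = 0) : ∃ q : A, a = q * (θ - ε * h) := by
  -- `a` kills `F/εF`, so `a = bθ + εc = b(θ - εh) + ε(c + bh)`
  obtain ⟨b, c, hbc⟩ := hann a (fun s => ⟨0, by rw [ha s, smul_zero]⟩)
  -- `ε (c + b h)` kills `F`, hence `c + b h` kills `F/εF`
  have hring : ε * (c + b * h) = a - b * (θ - ε * h) := by rw [hbc]; ring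
  have hkill : ∀ s : F, ∃ u : F, (c + b * h) • s = ε • u := by
    intro s
    have h0 : ε • ((c + b * h) • s) = 0 := by
      rw [smul_smul, hring, sub_smul, ha s, mul_smul, hh s, smul_zero, sub_zero]
    obtain ⟨t, ht⟩ := hflat _ h0
    exact ⟨t, ht⟩
  obtain ⟨b', c', hbc'⟩ := hann _ hkill
  refine ⟨b + ε * b', ?_⟩
  -- a = bθ + εc, and ε(c + bh) = ε(b'θ + εc') = εb'θ = εb'(θ - εh) since ε² = 0
  have key : ε * (c + b * h) = ε * b' * (θ - ε * h) := by
    rw [hbc']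
    have : ε * (b' * θ + ε * c') = ε * b' * θ + ε * ε * c' := by ring
    rw [this, hε2, zero_mul, add_zero]
    have : ε * b' * (θ - ε * h) = ε * b' * θ - ε * ε * (b' * h) := by ring
    rw [this, hε2, zero_mul, sub_zero]
  calc a = b * θ + ε * c := hbc
    _ = b * (θ - ε * h) + ε * (c + b * h) := by ring
    _ = b * (θ - ε * h) + ε * b' * (θ - ε * h) := by rw [key]
    _ = (b + ε * b') * (θ - ε * h) := by ring

end SupportLemma

section SmoothingObstruction

/-! ### Lemma N: modules with a matrix factorization do not lift along a deformation displacing the singular point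

Dictionary. `S = 𝒪_{X,x₀}` (regular local ring of the ambient abelian variety at a node `x₀` of `Θ = {f = 0}`); the
first-order deformation `Θ'_ε = {f + εh = 0}` of `Θ` inside `X_ε ≅ X × Spec ℂ[ε]` (locally) has local ring
`S[ε]/(ε², f + εh)`, and when `h(x₀) ≠ 0` — the node does not persist to first order; by the heat equation for theta
functions this is `⟨ξ, Q_{x₀}⟩ ≠ 0` for the Kodaira–Spencer class `ξ ∈ Sym² T₀X` and the tangent cone `Q_{x₀}`
[ArbarelloEtAl1985, Ch. VI §4, pp. 249–253] — this ring is `S/(f²)` with `ε = -f/h`. A `ℂ[ε]`-flat lift of an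
`𝒪_{Θ,x₀} = S/(f)`-module `M` to `Θ'_ε` is then an `S`-module `N` with `N/fN ≅ M` and `ker(f •) = f • N` (`hflat`).
A maximal Cohen–Macaulay `S/(f)`-module is `coker(A : S^r → S^r)` for a matrix factorization `A B = B A = f · 1`
[Eisenbud1980, §5–6]; its generators `n_k ∈ N` (lifting the images of the standard basis) satisfy the column relations
`∑_i A_{ij} n_i ∈ f N` (`hrel`). The module has no free summand iff all entries of `B` lie in the maximal ideal. -/

variable {S : Type*} [CommRing S] {N : Type*} [AddCommGroup N] [Module S N]
variable {ι : Type*} [Fintype ι] [DecidableEq ι]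

/-- **Lemma N (core identity).** If `A B = f · 1` entrywise (`hAB`), `N` is `f`-flat (`hflat`), and `n : ι → N` satisfies the
relations of `coker A` modulo `f • N` (`hrel`: `∑_i A i j • n i = f • m j`), then every `n k` lies in
`∑_j B j k • N + f • N`: precisely `n k = ∑_j B j k • m j + f • n'`. (Multiply the relations by `B`: `f • n k =
∑_j B j k • (∑_i A i j • n i) = f • ∑_j B j k • m j`, and use flatness.) With `B ⊂ 𝔪` this puts every generator of
`M = N/fN` into `𝔪 M`. [cite: Eisenbud1980, §5–6 (matrix factorizations of maximal Cohen–Macaulay modules over hypersurfaces)] -/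
theorem generator_mem_of_matrixFactorization_lift (f : S) (A B : ι → ι → S)
    (hAB : ∀ i k, ∑ j, A i j * B j k = if i = k then f else 0)
    (hflat : ∀ x : N, f • x = 0 → ∃ y : N, x = f • y)
    (n m : ι → N) (hrel : ∀ j, ∑ i, A i j • n i = f • m j) (k : ι) :
    ∃ n' : N, n k = (∑ j, B j k • m j) + f • n' := by
  have key : f • n k = f • ∑ j, B j k • m j := by
    have step1 : f • n k = ∑ i, (∑ j, A i j * B j k) • n i := by
      have : ∀ i, (∑ j, A i j * B j k) • n i = if i = k then f • n i else 0 := by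
        intro i
        rw [hAB i k]
        split_ifs with hik
        · rfl
        · rw [zero_smul]
      rw [Finset.sum_congr rfl (fun i _ => this i), Finset.sum_ite_eq' Finset.univ k (fun i => f • n i)]
      simp only [Finset.mem_univ, if_true]
    have step2 : ∑ i, (∑ j, A i j * B j k) • n i = ∑ j, B j k • ∑ i, A i j • n i := by
      simp_rw [Finset.sum_smul, Finset.smul_sum, smul_smul]
      rw [Finset.sum_comm]
      refine Finset.sum_congr rfl (fun j _ => Finset.sum_congr rfl (fun i _ => ?_))
      rw [mul_comm]
    rw [step1, step2]
    simp_rw [hrel, smul_smul, mul_comm _ f, ← smul_smul, ← Finset.smul_sum]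
  have h0 : f • (n k - ∑ j, B j k • m j) = 0 := by rw [smul_sub, key, sub_self]
  obtain ⟨n', hn'⟩ := hflat _ h0
  exact ⟨n', by rw [← hn']; abel⟩

/-- **Lemma N (no flat lift when the cofactor matrix lies in the maximal ideal).** In the situation of
`generator_mem_of_matrixFactorization_lift`, if all entries of `B` and `f` itself lie in an ideal `𝔪` contained in the
Jacobson radical (`S` local, `𝔪` its maximal ideal: the module `coker A` is maximal Cohen–Macaulay WITHOUT FREE SUMMAND) and the
`n k` generate `N` (lifts of generators generate, `ε` being nilpotent), then `N = 0`. Hence a non-zero maximal Cohen–Macaulay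
module without free summand over the hypersurface `S/(f)` — e.g. the ideal of a smooth Weil divisor through a threefold node,
such as `𝓘_{W_{2,p}} ⊂ 𝒪_Θ` at a `g¹₃` of a genus-4 Jacobian [Markman2025SecantWeil, Example 8.2.4] — admits NO flat lift to
a first-order deformation `{f + εh = 0}` with `h` a unit (a deformation that does not preserve the singular point).
[cite: Eisenbud1980, §5–6] -/
theorem eq_bot_of_matrixFactorization_lift (f : S) (A B : ι → ι → S) (𝔪 : Ideal S)
    (hAB : ∀ i k, ∑ j, A i j * B j k = if i = k then f else 0)
    (hB : ∀ j k, B j k ∈ 𝔪) (hf : f ∈ 𝔪) (hjac : 𝔪 ≤ (⊥ : Ideal S).jacobson)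
    (hflat : ∀ x : N, f • x = 0 → ∃ y : N, x = f • y)
    (n m : ι → N) (hrel : ∀ j, ∑ i, A i j • n i = f • m j)
    (hgen : Submodule.span S (Set.range n) = ⊤) :
    (⊤ : Submodule S N) = ⊥ := by
  have hfg : (⊤ : Submodule S N).FG := by
    rw [← hgen]; exact Submodule.fg_span (Set.finite_range n)
  refine Submodule.eq_bot_of_le_smul_of_le_jacobson_bot 𝔪 ⊤ hfg ?_ hjac
  -- every generator lies in 𝔪 • ⊤
  have hnk : ∀ k, n k ∈ 𝔪 • (⊤ : Submodule S N) := by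
    intro k
    obtain ⟨n', hn'⟩ := generator_mem_of_matrixFactorization_lift f A B hAB hflat n m hrel k
    rw [hn']
    refine Submodule.add_mem _ (Submodule.sum_mem _ (fun j _ => ?_)) ?_
    · exact Submodule.smul_mem_smul (hB j k) Submodule.mem_top
    · exact Submodule.smul_mem_smul hf Submodule.mem_top
  have hspan : Submodule.span S (Set.range n) ≤ 𝔪 • (⊤ : Submodule S N) := by
    rw [Submodule.span_le]
    rintro _ ⟨k, rfl⟩
    exact hnk k
  rwa [hgen] at hspan

/-- **Lemma N, rank-one node case made explicit.** For the threefold node `f = x y - z w` and the plane `x = z = 0` through it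
(the local model of `W_{2,p} ⊂ Θ` at a `g¹₃` of a non-hyperelliptic genus-4 curve with two `g¹₃`'s: the tangent cone of `Θ`
is the rank-4 quadric through the canonical curve [ArbarelloEtAl1985, Ch. VI §1, §4]), the ideal `(x, z) ⊂ S/(f)` is presented
by `A = [[y, z], [-w, -x]]` with cofactor `B = [[x, z], [-w, -y]]`, `A B = f · 1`, all entries in `𝔪 = (x, y, z, w)`.
Elementwise consequence used in the ladder note: if `N` is `f`-flat and `n₁, n₂ ∈ N` satisfy the two relations
`y • n₁ - w • n₂ ∈ f • N`, `z • n₁ - x • n₂ ∈ f • N` (those of the generators `x̄, z̄` of the ideal), then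
`n₁ ∈ x • N + w • N + f • N` — so the image `x̄` of `n₁` in `N/fN` would lie in `𝔪 · (x̄, z̄)`, which is false in
`S/(f)` (`x ∉ 𝔪²`). [cite: Markman2025SecantWeil, Example 8.2.4 (the Weil divisor `W_{2,p}` through the two singular points of `Θ`)] -/
theorem node_generator_mem {x y z w : S} (hflat : ∀ v : N, (x * y - z * w) • v = 0 → ∃ u : N, v = (x * y - z * w) • u)
    {n₁ n₂ m₁ m₂ : N} (h₁ : y • n₁ - w • n₂ = (x * y - z * w) • m₁) (h₂ : z • n₁ - x • n₂ = (x * y - z * w) • m₂) :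
    ∃ u : N, n₁ = x • m₁ - w • m₂ + (x * y - z * w) • u := by
  have key : (x * y - z * w) • n₁ = x • (y • n₁ - w • n₂) - w • (z • n₁ - x • n₂) := by
    simp only [smul_sub, smul_smul, sub_smul, mul_comm w x, mul_comm w z]
    abel
  rw [h₁, h₂, smul_comm x (x * y - z * w) m₁, smul_comm w (x * y - z * w) m₂, ← smul_sub] at key
  have h0 : (x * y - z * w) • (n₁ - (x • m₁ - w • m₂)) = 0 := by rw [smul_sub, key, sub_self]
  obtain ⟨u, hu⟩ := hflat _ h0
  exact ⟨u, by rw [← hu]; abel⟩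

end SmoothingObstruction

section SyzygyLift

/-! ### Syzygies of flat lifts are flat lifts of syzygies (from maximal Cohen–Macaulay to infinite projective dimension)

With `f • f = 0` on the modules (they live on `S/(f²) = S[ε]/(ε², f + εh)`, `h` a unit), a surjection `p : L → N` from an
`f`-flat module `L` (e.g. free over `S/(f²)`) onto an `f`-flat `N` has an `f`-flat kernel `K` (`syzygy_flat`) whose reduction
`K/fK` is the kernel of `L/fL → N/fN` (`syzygy_reduction_surjective`, `syzygy_inter`): the first syzygy of a liftable module
lifts. Iterating down to a maximal Cohen–Macaulay syzygy and applying `eq_bot_of_matrixFactorization_lift`, a module over the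
hypersurface `S/(f)` that lifts flatly along `{f + εh = 0}`, `h(x₀) ≠ 0`, has FINITE projective dimension; a rank-one
torsion-free module whose reflexive hull is not invertible at `x₀` has infinite projective dimension (its divisor class is
non-zero; Bourbaki, Alg. Comm. VII §4.7), hence does not lift. -/

variable {S : Type*} [CommRing S] {L N : Type*} [AddCommGroup L] [Module S L] [AddCommGroup N] [Module S N]

/-- **Syzygy lift (i): the kernel is flat.** If `p : L → N` is surjective, `L` is `f`-flat with `f² = 0` on `L`, and `N` is
`f`-flat, then every `k ∈ ker p` with `f • k = 0` is `f • k'` for some `k' ∈ ker p` (surjectivity of `p` is used to correct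
the preimage). [cite: Eisenbud1980, §5–6] -/
theorem syzygy_flat {f : S} (p : L →ₗ[S] N) (hp : Function.Surjective p)
    (hL : ∀ x : L, f • x = 0 → ∃ y : L, x = f • y) (hL2 : ∀ x : L, f • f • x = 0)
    (hN : ∀ x : N, f • x = 0 → ∃ y : N, x = f • y)
    {k : L} (hk : p k = 0) (hfk : f • k = 0) : ∃ k' : L, p k' = 0 ∧ k = f • k' := by
  obtain ⟨l, rfl⟩ := hL k hfk
  -- p l is killed by f, hence p l = f • n = f • p l''
  have hpl : f • p l = 0 := by rw [← map_smul, hk]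
  obtain ⟨n, hn⟩ := hN _ hpl
  obtain ⟨l'', rfl⟩ := hp n
  refine ⟨l - f • l'', ?_, ?_⟩
  · rw [map_sub, map_smul, ← hn, sub_self]
  · rw [smul_sub, hL2, sub_zero]

/-- **Syzygy lift (ii): `K ∩ fL = fK`.** Under the same hypotheses, an element of the form `f • l` lying in `ker p` is
`f • k'` with `k' ∈ ker p`. [cite: Eisenbud1980, §5–6] -/
theorem syzygy_inter {f : S} (p : L →ₗ[S] N) (hp : Function.Surjective p) (hL2 : ∀ x : L, f • f • x = 0)
    (hN : ∀ x : N, f • x = 0 → ∃ y : N, x = f • y)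
    {l : L} (hl : p (f • l) = 0) : ∃ k' : L, p k' = 0 ∧ f • l = f • k' := by
  have hpl : f • p l = 0 := by rw [← map_smul, hl]
  obtain ⟨n, hn⟩ := hN _ hpl
  obtain ⟨l'', rfl⟩ := hp n
  refine ⟨l - f • l'', ?_, ?_⟩
  · rw [map_sub, map_smul, ← hn, sub_self]
  · rw [smul_sub, hL2, sub_zero]

/-- **Syzygy lift (iii): `K/fK` maps onto the kernel of the reductions.** If `p l ∈ f • N` then `l ∈ ker p + f • L`.
Together with (i), (ii): `ker p` is an `f`-flat lift of `ker(L/fL → N/fN)`, the first syzygy of the reduction of `N` with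
respect to the presentation `L/fL`. [cite: Eisenbud1980, §5–6] -/
theorem syzygy_reduction_surjective {f : S} (p : L →ₗ[S] N) (hp : Function.Surjective p)
    {l : L} (hl : ∃ n : N, p l = f • n) : ∃ k' l' : L, p k' = 0 ∧ l = k' + f • l' := by
  obtain ⟨n, hn⟩ := hl
  obtain ⟨l'', rfl⟩ := hp n
  refine ⟨l - f • l'', l'', ?_, ?_⟩
  · rw [map_sub, map_smul, hn, sub_self]
  · abel

end SyzygyLift

section ParityArithmetic

/-! ### The parity barrier on principally polarized fourfolds: the arithmetic (ladder note P1 gen 3, Theorem P)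

On a principally polarized abelian FOURFOLD with `α = 1 − (d/2)Θ² + (d²/24)Θ⁴`, `β = Θ − (d/6)Θ³` (Markman's secant plane
`B_{√−dΘ} = span(α, β)`, [Markman2025SecantWeil, Ex. 8.2.3]), an object `F` with `ch(F) = aα + bβ` has `rk F = a`, `c₁(F) = bΘ`,
`ch₂(F) = −(ad/2)Θ²`, `ch₃(F) = −(bd/6)Θ³`. Writing `c₂(F) = γ₂·Θ²/2` and `c₃(F) = γ₃·Θ³/6` in terms of the primitive classes
`Θ²/2`, `Θ³/6`, the universal formulas `ch₂ = (c₁² − 2c₂)/2`, `ch₃ = (c₁³ − 3c₁c₂ + 3c₃)/6` give `γ₂ = b² + ad` and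
`γ₃ = b³ − 2bd + 3abd` (`secant_gammaTwo`, `secant_gammaThree`; the powers of `Θ` are book-kept by their coefficients, `Θ²·Θ = Θ³`).
P. Engel, O. de Gaay Fortman, S. Schreieder, arXiv:2507.15704 (2025, UNREFEREED claim), Thm. 1.1: on a very general ppav of dimension
`g ≥ 4` every algebraic class of codimension `2 ≤ c ≤ g − 1` is an EVEN multiple of `[Θ]^c/c!`. Since `γ₃ ≡ b(b² + ad) (mod 2)`
(`even_gammaThree_iff`), the only parity constraint on an object that spreads to a very general ppav is `b² + ad` even; for a
torsion secant sheaf `e_*V` of rank `r = 2k` on a smooth theta divisor, Grothendieck–Riemann–Roch gives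
`e_*c₂(V) = (3k² − 2k + 2kd)·Θ³/6`, whose coefficient has the parity of `k` (`even_torsionGammaTwo_iff`): rank `≡ 0 (mod 4)` is
necessary. The geometry (spreading via Buchweitz–Flenner, algebraicity of Chern classes) is in the ladder note; only the arithmetic is
checked here. -/

/-- `γ₂ = b² + ad`: from `ch₂ = −(ad/2)` (coefficient of `Θ²`) and `ch₂ = (c₁² − 2c₂)/2` with `c₁ = b`, `c₂ = γ₂/2` (coefficient of
`Θ²`, in units where `Θ²/2` is the primitive class). [cite: Markman2025SecantWeil, Example 8.2.3 (the secant plane `span(α, β)`)] -/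
theorem secant_gammaTwo (a b d γ₂ : ℚ) (h : (b ^ 2 - 2 * (γ₂ / 2)) / 2 = -(a * d) / 2) : γ₂ = b ^ 2 + a * d := by
  linarith

/-- `γ₃ = b³ − 2bd + 3abd`: from `ch₃ = −(bd/6)` (coefficient of `Θ³`) and `ch₃ = (c₁³ − 3c₁c₂ + 3c₃)/6` with `c₁ = b`,
`c₁c₂ = b·(b² + ad)/2·Θ³` (as `Θ·Θ² = Θ³`), `c₃ = γ₃/6·Θ³`. [cite: Markman2025SecantWeil, Example 8.2.3] -/
theorem secant_gammaThree (a b d γ₃ : ℚ)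
    (h : (b ^ 3 - 3 * (b * ((b ^ 2 + a * d) / 2)) + 3 * (γ₃ / 6)) / 6 = -(b * d) / 6) :
    γ₃ = b ^ 3 - 2 * b * d + 3 * a * b * d := by
  linarith

/-- The parity of `γ₃ = b³ − 2bd + 3abd` is that of `b·γ₂ = b(b² + ad)`: the codimension-3 condition of the parity barrier follows
from the codimension-2 one. [cite: EngelDeGaayFortmanSchreieder2025, Thm. 1.1 (even multiples on very general ppav, g ≥ 4)] -/
theorem even_gammaThree_iff (a b d : ℤ) :
    Even (b ^ 3 - 2 * b * d + 3 * a * b * d) ↔ Even (b * (b ^ 2 + a * d)) := by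
  have h : Even (b ^ 3 - 2 * b * d + 3 * a * b * d - b * (b ^ 2 + a * d)) :=
    ⟨b * d * (a - 1), by ring⟩
  exact Int.even_sub.mp h

/-- Torsion secant sheaves on `Θ`: for `e_*V` with `V` of rank `r = 2k` on a smooth theta divisor of a pp fourfold, the coefficient
`3k² − 2k + 2kd` of `e_*c₂(V)` in units of the minimal class `Θ³/6` has the parity of `k`; with the cited theorem, rank `≡ 0 (mod 4)`
is necessary for such a sheaf to spread to a very general ppav. [cite: EngelDeGaayFortmanSchreieder2025, Thm. 1.1] -/
theorem even_torsionGammaTwo_iff (k d : ℤ) : Even (3 * k ^ 2 - 2 * k + 2 * k * d) ↔ Even k := by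
  have h1 : Even ((k - 1) * (k - 1 + 1)) := Int.even_mul_succ_self (k - 1)
  have h : Even (3 * k ^ 2 - 2 * k + 2 * k * d - k) := by
    obtain ⟨m, hm⟩ := h1
    exact ⟨3 * m + k * d, by nlinarith [hm]⟩
  exact Int.even_sub.mp h

/-- **Instances of the parity barrier.** `γ₂ = b² + ad` is ODD for: every torsion secant sheaf with `ch₁ = Θ` (`a = 0`, `b = 1`:
Markman's `F_d`, and `E₀`, `F′` of arXiv:2509.23079 §11.2), and the rank-one designs `(a, b, d) = (1, 2, 1), (1, 2, 3)`; it is EVEN for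
`(1, 2, 2)`, `(1, 3, 7)` and every `(2, 0, d)`. [cite: Markman2025SecantWeil, Example 8.2.4] -/
theorem parityBarrier_instances :
    Odd ((1:ℤ) ^ 2 + 0 * 5) ∧ Odd ((2:ℤ) ^ 2 + 1 * 1) ∧ Odd ((2:ℤ) ^ 2 + 1 * 3) ∧
      Even ((2:ℤ) ^ 2 + 1 * 2) ∧ Even ((3:ℤ) ^ 2 + 1 * 7) ∧ ∀ d : ℤ, Even ((0:ℤ) ^ 2 + 2 * d) := by
  refine ⟨by decide, by decide, by decide, by decide, by decide, fun d => ⟨d, by ring⟩⟩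

end ParityArithmetic

end Literature.AlgebraicGeometry.HodgeTheory
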